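import Mathlib
import Literature.Probability.PointProcesses.LensConsistentLaw
import Literature.MathematicalPhysics.StatisticalMechanics.LennardJonesClusters
import Literature.MathematicalPhysics.StatisticalMechanics.BarlowStacking
import Literature.Probability.Process.RootedHardCoreVague
import Literature.Probability.Process.PointStationaryLaw
import Summits.AtomisticToContinuum.Crystallization.Theorems.FrustrationRangeCertificatesPatternPricedCertificatesStubLevelLift
import Summits.AtomisticToContinuum.Crystallization.Theorems.FrustrationRangeCertificatesPatternPricedCertificatesStubBanachLimit
import HarnessLib

/-!
# Crux `PatternPricedCertificates` (stmt-AtomisticToContinuum-12974), line `registered`: stub `stub_meanToLaw`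

Riesz representation of a finitely additive mean family on rooted patterns by a probability law on the compact
configuration space `RootedHardCoreConfig ℝ³ δ` (Banach limit + Riesz–Markov–Kakutani). Bridge stub B1 of the line.
-/

noncomputable section

open scoped BigOperators Classical
open MeasureTheory

namespace Summit.AtomisticToContinuum.Crystallization.Theorems.PatternPricedCertificates

/-- A generalised limit which ignores finitely many terms agrees on eventually equal sequences.
[folklore] -/
theorem meanToLaw_congr_of_eventuallyEq {Λ : (ℕ → ℝ) → ℝ}
    (hadd : ∀ a b : ℕ → ℝ, Λ (a + b) = Λ a + Λ b)
    (hsmul : ∀ (t : ℝ) (a : ℕ → ℝ), Λ (t • a) = t * Λ a)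
    (hzero : ∀ a : ℕ → ℝ, (∃ n₀ : ℕ, ∀ n, n₀ ≤ n → a n = 0) → Λ a = 0)
    {a b : ℕ → ℝ} {n₀ : ℕ} (hab : ∀ n, n₀ ≤ n → a n = b n) : Λ a = Λ b := by
  have h1 : Λ (a - b) = 0 := hzero _ ⟨n₀, fun n hn => by simp [hab n hn]⟩
  rw [levelLift_mean_sub hadd hsmul] at h1
  linarith

/-- An eventual lower bound of a sequence bounded above is a lower bound for its generalised
limit. [folklore] -/
theorem meanToLaw_le_of_eventually_le {Λ : (ℕ → ℝ) → ℝ}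
    (hadd : ∀ a b : ℕ → ℝ, Λ (a + b) = Λ a + Λ b)
    (hsmul : ∀ (t : ℝ) (a : ℕ → ℝ), Λ (t • a) = t * Λ a)
    (hpos : ∀ a : ℕ → ℝ, (∀ n, 0 ≤ a n ∧ a n ≤ 1) → 0 ≤ Λ a)
    (hone : Λ (fun _ => 1) = 1)
    (hzero : ∀ a : ℕ → ℝ, (∃ n₀ : ℕ, ∀ n, n₀ ≤ n → a n = 0) → Λ a = 0)
    {a : ℕ → ℝ} {C c : ℝ} (hC : ∀ n, a n ≤ C) {n₀ : ℕ}
    (hc : ∀ n, n₀ ≤ n → c ≤ a n) : c ≤ Λ a := by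
  have hpos' : ∀ b : ℕ → ℝ, (∀ n, True → 0 ≤ b n ∧ b n ≤ 1) → 0 ≤ Λ b :=
    fun b hb => hpos b fun n => hb n trivial
  have hΛ : Λ (fun n => if n₀ ≤ n then a n else c) = Λ a :=
    meanToLaw_congr_of_eventuallyEq hadd hsmul hzero (n₀ := n₀) fun n hn => by simp [hn]
  have h := (levelLift_mean_mem_Icc (Ω := fun _ => True) hadd hsmul hpos' hone
    (f := fun n => if n₀ ≤ n then a n else c) (lo := c) (hi := max c C + 1)
    (by linarith [le_max_left c C]) (fun n _ => ?_)).1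
  · rwa [hΛ] at h
  · by_cases hn : n₀ ≤ n
    · simp only [if_pos hn]
      exact ⟨hc n hn, by linarith [le_max_right c C, hC n]⟩
    · simp only [if_neg hn]
      exact ⟨le_rfl, by linarith [le_max_left c C]⟩

/-- An eventual upper bound of a sequence bounded below is an upper bound for its generalised
limit. [folklore] -/
theorem meanToLaw_ge_of_eventually_ge {Λ : (ℕ → ℝ) → ℝ}
    (hadd : ∀ a b : ℕ → ℝ, Λ (a + b) = Λ a + Λ b)
    (hsmul : ∀ (t : ℝ) (a : ℕ → ℝ), Λ (t • a) = t * Λ a)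
    (hpos : ∀ a : ℕ → ℝ, (∀ n, 0 ≤ a n ∧ a n ≤ 1) → 0 ≤ Λ a)
    (hone : Λ (fun _ => 1) = 1)
    (hzero : ∀ a : ℕ → ℝ, (∃ n₀ : ℕ, ∀ n, n₀ ≤ n → a n = 0) → Λ a = 0)
    {a : ℕ → ℝ} {C c : ℝ} (hC : ∀ n, C ≤ a n) {n₀ : ℕ}
    (hc : ∀ n, n₀ ≤ n → a n ≤ c) : Λ a ≤ c := by
  have hpos' : ∀ b : ℕ → ℝ, (∀ n, True → 0 ≤ b n ∧ b n ≤ 1) → 0 ≤ Λ b :=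
    fun b hb => hpos b fun n => hb n trivial
  have hΛ : Λ (fun n => if n₀ ≤ n then a n else c) = Λ a :=
    meanToLaw_congr_of_eventuallyEq hadd hsmul hzero (n₀ := n₀) fun n hn => by simp [hn]
  have h := (levelLift_mean_mem_Icc (Ω := fun _ => True) hadd hsmul hpos' hone
    (f := fun n => if n₀ ≤ n then a n else c) (lo := min c C - 1) (hi := c)
    (by linarith [min_le_left c C]) (fun n _ => ?_)).2
  · rwa [hΛ] at h
  · by_cases hn : n₀ ≤ n
    · simp only [if_pos hn]
      exact ⟨by linarith [min_le_right c C, hC n], hc n hn⟩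
    · simp only [if_neg hn]
      exact ⟨by linarith [min_le_left c C], le_rfl⟩

/-- **Riesz–Markov–Kakutani for means on a compact space.** An additive, homogeneous functional
on all real functions on a compact Hausdorff space which is nonnegative on `[0, 1]`-valued
functions and normalised is represented on continuous functions by a Borel probability measure
(`RealRMK.rieszMeasure` of its restriction to `C_c = C`). [folklore] -/
theorem meanToLaw_exists_measure {X : Type*} [TopologicalSpace X] [T2Space X] [CompactSpace X]
    [MeasurableSpace X] [BorelSpace X] {m : (X → ℝ) → ℝ}
    (hadd : ∀ f g : X → ℝ, m (f + g) = m f + m g)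
    (hsmul : ∀ (t : ℝ) (f : X → ℝ), m (t • f) = t * m f)
    (hpos : ∀ f : X → ℝ, (∀ x, 0 ≤ f x ∧ f x ≤ 1) → 0 ≤ m f)
    (hone : m (fun _ => 1) = 1) :
    ∃ Q : Measure X, IsProbabilityMeasure Q ∧
      ∀ F : X → ℝ, Continuous F → ∫ x, F x ∂Q = m F := by
  have hpos' : ∀ f : X → ℝ, (∀ x, True → 0 ≤ f x ∧ f x ≤ 1) → 0 ≤ m f :=
    fun f hf => hpos f fun x => hf x trivial
  let L : CompactlySupportedContinuousMap X ℝ →ₚ[ℝ] ℝ :=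
    { toFun := fun F => m F
      map_add' := fun F G => by
        rw [CompactlySupportedContinuousMap.coe_add]
        exact hadd _ _
      map_smul' := fun t F => by
        rw [CompactlySupportedContinuousMap.coe_smul, RingHom.id_apply, smul_eq_mul]
        exact hsmul t _
      monotone' := fun F G hFG => by
        obtain ⟨C, hC⟩ :=
          (G - F).hasCompactSupport.exists_bound_of_continuous (G - F).continuous
        refine levelLift_mean_mono (Ω := fun _ => True) hadd hsmul hpos' (M := |C| + 1)
          (by positivity) (fun x _ => CompactlySupportedContinuousMap.le_def.1 hFG x) fun x _ => ?_
        have h1 : G x - F x ≤ C := by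
          have h := hC x
          rw [CompactlySupportedContinuousMap.coe_sub, Pi.sub_apply, Real.norm_eq_abs] at h
          exact (le_abs_self _).trans h
        linarith [le_abs_self C] }
  have hrep : ∀ F : X → ℝ, Continuous F → ∫ x, F x ∂(RealRMK.rieszMeasure L) = m F :=
    fun F hF =>
      RealRMK.integral_rieszMeasure L ⟨⟨F, hF⟩, HasCompactSupport.of_compactSpace F⟩
  refine ⟨RealRMK.rieszMeasure L, ?_, hrep⟩
  have h1 := hrep (fun _ => (1 : ℝ)) continuous_const
  rw [hone, integral_const, smul_eq_mul, mul_one] at h1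
  exact isProbabilityMeasure_iff_real.2 h1

/-- **Stub B1 (Riesz representation of a mean family on the compact configuration space).** For `δ > 0`, a
finite embedding `ι` of patterns into rooted `δ`-hard-core configurations and a mean family `ℓ` (additive, homogeneous,
positive on `[0,1]`-valued functionals on admissible patterns, normalised), there is a probability law `Q` on
`RootedHardCoreConfig ℝ³ δ` such that for every continuous `F`, `∫ F dQ` lies between the eventual lower and upper
bounds of `n ↦ ℓ n (F ∘ ι)` (a Banach limit of `n ↦ ℓ n (F ∘ ι)` is a positive normalised linear functional on
`C(𝒳) = C_c(𝒳)`; Riesz–Markov–Kakutani `RealRMK.rieszMeasure`, `integral_rieszMeasure`). [folklore] -/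
theorem stub_meanToLaw :
    ∀ δ : ℝ, 0 < δ → ∀ ι : Finset (EuclideanSpace ℝ (Fin 3)) → Literature.Probability.Process.LocalConfig.RootedHardCoreConfig (EuclideanSpace ℝ (Fin 3)) δ, ∀ ℓ : ℝ → (Finset (EuclideanSpace ℝ (Fin 3)) → ℝ) → ℝ,
      (∀ (ρ : ℝ) (f₁ f₂ : Finset (EuclideanSpace ℝ (Fin 3)) → ℝ), ℓ ρ (f₁ + f₂) = ℓ ρ f₁ + ℓ ρ f₂) →
      (∀ (ρ t : ℝ) (f : Finset (EuclideanSpace ℝ (Fin 3)) → ℝ), ℓ ρ (t • f) = t * ℓ ρ f) →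
      (∀ (ρ : ℝ) (f : Finset (EuclideanSpace ℝ (Fin 3)) → ℝ), (∀ S : Finset (EuclideanSpace ℝ (Fin 3)), Literature.Probability.PointProcesses.IsRootedPattern δ ρ S → 0 ≤ f S ∧ f S ≤ 1) → 0 ≤ ℓ ρ f) →
      (∀ ρ : ℝ, ℓ ρ (fun _ => 1) = 1) →
      ∃ Q : MeasureTheory.Measure (Literature.Probability.Process.LocalConfig.RootedHardCoreConfig (EuclideanSpace ℝ (Fin 3)) δ), MeasureTheory.IsProbabilityMeasure Q ∧
        (∀ F : Literature.Probability.Process.LocalConfig.RootedHardCoreConfig (EuclideanSpace ℝ (Fin 3)) δ → ℝ, Continuous F → ∀ c : ℝ, ((∃ n₀ : ℕ, ∀ n : ℕ, n₀ ≤ n → c ≤ ℓ (n : ℝ) (fun T => F (ι T))) → c ≤ ∫ x, F x ∂Q) ∧ ((∃ n₀ : ℕ, ∀ n : ℕ, n₀ ≤ n → ℓ (n : ℝ) (fun T => F (ι T)) ≤ c) → ∫ x, F x ∂Q ≤ c)) := by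
  intro δ hδ ι ℓ hadd hsmul hpos hone
  haveI : Fact (0 < δ) := ⟨hδ⟩
  obtain ⟨Λ, hΛadd, hΛsmul, hΛpos, hΛone, hΛzero⟩ := stub_banachLimit
  -- each `ℓ n` maps functionals with values in `[lo, hi]` into `[lo, hi]`
  have hℓIcc : ∀ (n : ℕ) (f : Finset (EuclideanSpace ℝ (Fin 3)) → ℝ) (lo hi : ℝ),
      lo < hi → (∀ S, lo ≤ f S ∧ f S ≤ hi) → lo ≤ ℓ n f ∧ ℓ n f ≤ hi :=
    fun n f lo hi hlh hf =>
      levelLift_mean_mem_Icc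
        (Ω := fun S => Literature.Probability.PointProcesses.IsRootedPattern δ n S)
        (hadd n) (hsmul n) (hpos n) (hone n) hlh fun S _ => hf S
  -- the composite mean `m f := Λ (n ↦ ℓ n (f ∘ ι))` on functions of configurations
  obtain ⟨m, hm⟩ : ∃ m : (Literature.Probability.Process.LocalConfig.RootedHardCoreConfig
      (EuclideanSpace ℝ (Fin 3)) δ → ℝ) → ℝ,
      ∀ f, m f = Λ (fun n : ℕ => ℓ n (fun T => f (ι T))) :=
    ⟨_, fun f => rfl⟩
  have hmadd : ∀ f g : _ → ℝ, m (f + g) = m f + m g := by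
    intro f g
    rw [hm, hm, hm, ← hΛadd]
    congr 1
    funext n
    exact hadd n (fun T => f (ι T)) (fun T => g (ι T))
  have hmsmul : ∀ (t : ℝ) (f : _ → ℝ), m (t • f) = t * m f := by
    intro t f
    rw [hm, hm, ← hΛsmul]
    congr 1
    funext n
    exact hsmul n t (fun T => f (ι T))
  have hmpos : ∀ f : _ → ℝ, (∀ x, 0 ≤ f x ∧ f x ≤ 1) → 0 ≤ m f := by
    intro f hf
    rw [hm]
    exact hΛpos _ fun n => hℓIcc n _ 0 1 zero_lt_one fun S => hf (ι S)
  have hmone : m (fun _ => 1) = 1 := by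
    rw [hm]
    exact (congrArg Λ (funext fun n => hone n)).trans hΛone
  obtain ⟨Q, hQ, hrep⟩ := meanToLaw_exists_measure hmadd hmsmul hmpos hmone
  refine ⟨Q, hQ, fun F hF c => ?_⟩
  -- `F` is bounded on the compact configuration space, so `n ↦ ℓ n (F ∘ ι)` is bounded
  obtain ⟨C, hC⟩ := (HasCompactSupport.of_compactSpace F).exists_bound_of_continuous hF
  have hFb : ∀ x, -(|C| + 1) ≤ F x ∧ F x ≤ |C| + 1 := fun x => by
    have h := hC x
    rw [Real.norm_eq_abs] at h
    constructor <;> linarith [neg_abs_le (F x), le_abs_self (F x), le_abs_self C]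
  have hab : ∀ n : ℕ,
      -(|C| + 1) ≤ ℓ n (fun T => F (ι T)) ∧ ℓ n (fun T => F (ι T)) ≤ |C| + 1 :=
    fun n => hℓIcc n _ _ _ (by linarith [abs_nonneg C]) fun S => hFb (ι S)
  rw [hrep F hF, hm]
  exact ⟨fun ⟨n₀, hn₀⟩ =>
      meanToLaw_le_of_eventually_le hΛadd hΛsmul hΛpos hΛone hΛzero (fun n => (hab n).2) hn₀,
    fun ⟨n₀, hn₀⟩ =>
      meanToLaw_ge_of_eventually_ge hΛadd hΛsmul hΛpos hΛone hΛzero (fun n => (hab n).1)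
        hn₀⟩

end Summit.AtomisticToContinuum.Crystallization.Theorems.PatternPricedCertificates

end
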